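import Literature.Computability.Cryptography.BLPRSThm41Skeleton
import Literature.Computability.Cryptography.BLPRSRateGuess
import HarnessLib

/-!
# BLPRS 2013, §3–§4 assembled at the level of laws: from a distinguisher of `LWE_{n,q',Ψ̄_α}` to ONE distinguisher of `LWE_{d,Q,Ψ̄_{α₂}}` (modulo Lemma 4.7)

Topic `Computability/Cryptography` (LWE), grouping namespace `BLPRS2013`. Proved glue (no named fact)
towards `Literature.Computability.Cryptography.blprs_gapSVP_sqrt_dim_to_lwe_classical` (**pqc.S21**):
the ANALYSIS of hypothesis `h₃` of `BLPRSReduction.lean` ("§3–§4: Thm. 4.1 + Cor. 3.2 + Lemma 2.15"),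
assembled from the tree's pieces, with BLPRS Lemma 4.7 in exactly the hypothesis form `h47` of
`LWE.blprs_theorem_4_1_bound` (`BLPRSThm41Skeleton.lean`, approach B; the one step of §4 not yet in the
tree). The chain, for a test `K` of `m₃` samples of `LWE_{n,q',Ψ̄_α}` (uniform secret) with advantage `≥ 4θ`:

1. `A := flatGuessTest K …` (rows `rateGuessKernel`: uniform secret shift + discretised modulus switch
   `Q → q'` with the noise raising of guess `w`, `BLPRSRateGuess.lean`; estimate-and-flag over the guesses,
   `LWERateGuessTest.lean` = Lemma 2.15) is a test of `m = G·(N·m₃)` samples of `binLWE` mod `Q` whose noise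
   is the FIRST HYBRID's law `noiseH₁ χ_N χ_h` of Lemma 4.9 (so Thm. 4.1's hypothesis `hη` holds with
   `η = 0`), with `Pr[A(H₀)] - Pr[A(U)] ≥ 1 - (4(G+1)/(Nθ²) + 8/(N'θ²))` (**`advantage_rateGuess_hybridH₀'`**: the
   form of `advantage_rateGuess_hybridH₀` in which `K` enters only through "for every secret `z` SOME guess `w`
   makes `Adv_{Ψ̄_{α(z,w)}}[K] ≥ 4θ`", `α(z,w)² = ρ₀(z̄)² + r²(‖z‖² + B²) + τ_w²` — what a finite-precision machine,
   whose guesses hit a target rate only approximately, can meet: `four_theta_le_adv_of_tvDist_le`);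
2. Thm. 4.1's bookkeeping (`LWE.blprs_theorem_4_1_bound`, dimension `k = d`, modulus `Q`) turns `A` into
   `E₁, E₃` (`m_fel` samples, source noise `χ_src`) and `E₂` (`m` samples, noise `χ_h`) with
   `m(Adv E₁ + ℓ) + Adv E₂ + m(Adv E₃ + ℓ) ≥ Pr[A(H₀)] - Pr[A(U)] - Δ_LHL`, `ℓ = ∑_{p∣Q} p^{-(d+1)} + L₄₇`
   (**`section4_three_candidates`**), hence ONE of them has advantage `≥ (T - 2mℓ)/(2m+1)`
   (`exists_ge_of_weighted_sum_ge`);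
3. with `χ_src = Ψ̄_{α₂}` and `χ_h = Ψ̄_{√(α₂²+u²)}` the three candidates become tests of ONE problem
   `LWE_{d,Q,Ψ̄_{α₂}}` on `M = max m m_fel` samples (`padThen`, `raiseThen`, `LWEDistinguisherTransport.lean`;
   the noise raising costs `m/(2Qα₂)`), and the selection by self-generated estimation
   (`selectDistinguisher`, `LWECandidateSelect.lean`) yields ONE test with advantage
   `≥ η⋆/2 - 2·3·32/(N_sel η⋆²)`, `η⋆ = (T - 2mℓ)/(2m+1) - m/(2Qα₂)` (**`section4_selected`**).

What remains for `h₃` itself after this file: Lemma 4.7 (discharging `h47`; approach B), the choice of the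
parameters in the regime of pqc.S21 (all losses `1/poly` or negligible eventually), and the MACHINE
(a `CodeFP` program with finite-precision Gaussian samplers realising `selectDistinguisher ∘ …`).

## References

* Z. Brakerski, A. Langlois, C. Peikert, O. Regev, D. Stehlé, *Classical hardness of learning with errors*,
  STOC 2013; arXiv:1306.0281, Thm. 4.1 and its proof (pp. 13, 16–17), Cor. 3.2, Lemma 2.15, Lemma 4.7,
  Lemma 4.9 and p. 13 ("combining Theorem 4.1 and Corollary 3.2 …"). [BrakerskiEtAl2013]
* O. Regev, *On lattices, learning with errors …*, J. ACM 56 (2009), Lemma 4.1. [RegevLWE2009]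
-/

noncomputable section

open MeasureTheory Literature.Algebra.EuclideanLattices Literature.Probability.Distributions
open scoped Real ENNReal

namespace Literature.Computability.Cryptography

namespace BLPRS2013

open LWE LWE.MP12

/-! ### One of three weighted candidates is large -/

/-- If `m(x₁ + ℓ) + x₂ + m(x₃ + ℓ) ≥ T` with `m ≥ 0`, then some `xᵢ ≥ (T - 2mℓ)/(2m + 1)`. [folklore] -/
theorem exists_ge_of_weighted_sum_ge {m x₁ x₂ x₃ ℓ T : ℝ} (hm : 0 ≤ m)
    (h : T ≤ m * (x₁ + ℓ) + x₂ + m * (x₃ + ℓ)) :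
    (T - 2 * m * ℓ) / (2 * m + 1) ≤ x₁ ∨ (T - 2 * m * ℓ) / (2 * m + 1) ≤ x₂ ∨ (T - 2 * m * ℓ) / (2 * m + 1) ≤ x₃ := by
  by_contra hnot
  simp only [not_or, not_le] at hnot
  obtain ⟨h1, h2, h3⟩ := hnot
  have hden : (0 : ℝ) < 2 * m + 1 := by linarith
  set c := (T - 2 * m * ℓ) / (2 * m + 1) with hc
  have hcT : (2 * m + 1) * c = T - 2 * m * ℓ := by
    rw [hc]; field_simp
  have : m * (x₁ + ℓ) + x₂ + m * (x₃ + ℓ) < m * (c + ℓ) + c + m * (c + ℓ) := by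
    nlinarith [mul_le_mul_of_nonneg_left h1.le hm, mul_le_mul_of_nonneg_left h3.le hm]
  nlinarith

/-! ### The rate-guess test when SOME guess makes `K`'s advantage large -/

section Guess

variable {n Q q' : ℕ} [NeZero Q] [NeZero q'] {r B : ℝ} {G : ℕ} {τ : Fin G → ℝ} {m₃ N N' : ℕ} {θ : ℝ}

/-- **The rate-guess test against `binLWE` mod `Q`, general form**: as `advantage_rateGuess_hybridH₀`
(`BLPRSRateGuess.lean`), but the exact-rate hypothesis "some guess `w` has switched-and-raised rate `= α`, and
`Adv_{Ψ̄_α}[K] ≥ 4θ`" is replaced by what its proof uses: for every secret `z` in the support SOME guess `w` makes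
`K`'s advantage against `LWE_{n,q',Ψ̄_{α(z,w)}}`, `α(z,w) = √(ρ₀(z̄)² + r²(‖z‖² + B²) + τ_w²)`, at least `4θ` — the
form a finite-precision machine can meet (its guesses hit the target rate only approximately,
`four_theta_le_adv_of_tvDist_le`). [cite: BrakerskiEtAl2013, p. 13 (Thm. 4.1 + Cor. 3.2 + Lemma 2.15); RegevLWE2009, Lemma 4.1] -/
theorem advantage_rateGuess_hybridH₀' {ε α₀ η₀ : ℝ} (hn : 0 < n) (hε : 0 < ε) (hε' : ε ≤ 1 / 2)
    (hr : max (Q : ℝ)⁻¹ (q' : ℝ)⁻¹ * Real.sqrt (2 * Real.log (2 * n * (1 + 1 / ε)) / π) ≤ r) (hα₀ : 0 < α₀)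
    (hN : 0 < N) (hN' : 0 < N') (hθ : 0 < θ)
    (K : (Fin m₃ → (Fin n → ZMod q') × ZMod q') → PMF Bool)
    (χ₀ : (Fin n → ZMod Q) → PMF (ZMod Q)) (ρ₀ : (Fin n → ZMod Q) → ℝ) (ζ : PMF (Fin n → ℤ))
    (hζ : ∀ z ∈ ζ.support, ‖intVecToEuclidean n z‖ ≤ B ∧ α₀ ≤ ρ₀ (intCastVec z) ∧
      (χ₀ (intCastVec z)).tvDist (discretizedGaussian Q (ρ₀ (intCastVec z))) ≤ η₀ ∧
      ∃ w : Fin G, 4 * θ ≤ distinguishingAdvantage (discretizedGaussian q'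
        (Real.sqrt (Real.sqrt (ρ₀ (intCastVec z) ^ 2 + r ^ 2 * (‖intVecToEuclidean n z‖ ^ 2 + B ^ 2)) ^ 2 + τ w ^ 2))) m₃ K)
    (hεθ : m₃ * (4 * ε) ≤ θ / 2) (hQθ : m₃ * (2 / (α₀ * Q) + 10 * ε) + m₃ * η₀ ≤ 2 * θ) :
    1 - ((G + 1) * (4 / (N * θ ^ 2)) + 8 / (N' * θ ^ 2)) ≤
      (acceptProb (flatGuessTest K N m₃ (rateGuessKernel n Q q' r B τ m₃) (uniformSamples (Fin n) (ZMod q') m₃) N' θ)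
          (hybridH₀ χ₀ (G * (N * m₃)) ζ)).toReal -
        (acceptProb (flatGuessTest K N m₃ (rateGuessKernel n Q q' r B τ m₃) (uniformSamples (Fin n) (ZMod q') m₃) N' θ)
          (uniformSamples (Fin n) (ZMod Q) (G * (N * m₃)))).toReal := by
  refine advantage_flatGuessTest_hybridH₀ K N (rateGuessKernel n Q q' r B τ m₃) (uniformSamples (Fin n) (ZMod q') m₃) N' θ
    χ₀ ζ hN hN' hθ (fun w => ?_) (fun z hz => ?_)
  · exact (abs_pacc_rateGuessKernel_uniform_sub_le hn hε hε' hr K w).trans hεθ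
  · obtain ⟨hzB, hρ, hχ, w, hKw⟩ := hζ z hz
    refine ⟨w, ?_⟩
    have hρ0 : 0 < ρ₀ (intCastVec z) := hα₀.trans_le hρ
    -- the Gaussian row is close to `LWE_{n,q',Ψ̄_{α(z,w)}}` with uniform secret …
    have hclose := abs_pacc_rateGuessKernel_lwe_sub_le (τ := τ) (m₃ := m₃) hn hε hε' hr hρ0 z hzB K w
    -- … the actual row is close to the Gaussian row …
    have hrow : |pacc K ((lweSamples (χ₀ (intCastVec z)) (intCastVec z : Fin n → ZMod Q) m₃).bind (rateGuessKernel n Q q' r B τ m₃ w)) -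
        pacc K ((lweSamples (discretizedGaussian Q (ρ₀ (intCastVec z))) (intCastVec z : Fin n → ZMod Q) m₃).bind
          (rateGuessKernel n Q q' r B τ m₃ w))| ≤ m₃ * η₀ :=
      (abs_pacc_bind_sub_le_tvDist K _ _ _).trans
        ((tvDist_lweSamples_le _ _ _ m₃).trans (mul_le_mul_of_nonneg_left hχ (Nat.cast_nonneg m₃)))
    -- … whose `K`-acceptance is `≥ 4θ` away from uniform
    have hadv : 4 * θ ≤ |pacc K (lweSamplesUniformSecret (discretizedGaussian q'
        (Real.sqrt (Real.sqrt (ρ₀ (intCastVec z) ^ 2 + r ^ 2 * (‖intVecToEuclidean n z‖ ^ 2 + B ^ 2)) ^ 2 + τ w ^ 2))) m₃) -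
          pacc K (uniformSamples (Fin n) (ZMod q') m₃)| :=
      hKw
    have hQ : (0 : ℝ) < Q := by exact_mod_cast Nat.pos_of_ne_zero (NeZero.ne Q)
    have hd : (m₃ : ℝ) * (2 / (ρ₀ (intCastVec z) * Q) + 10 * ε) + m₃ * η₀ ≤ 2 * θ := by
      refine le_trans ?_ hQθ
      have : 2 / (ρ₀ (intCastVec z) * Q) ≤ 2 / (α₀ * Q) := by
        apply div_le_div_of_nonneg_left (by norm_num) (by positivity)
        exact mul_le_mul_of_nonneg_right hρ hQ.le
      nlinarith [Nat.cast_nonneg (α := ℝ) m₃]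
    rw [abs_le] at hclose hrow
    rw [le_abs] at hadv ⊢
    rcases hadv with h | h
    · left; linarith [hclose.1, hclose.2, hrow.1, hrow.2]
    · right; linarith [hclose.1, hclose.2, hrow.1, hrow.2]

omit [NeZero Q] in
/-- **Approximately right rates suffice**: if `Adv_{Ψ̄_α}[K] ≥ 4θ + m₃η₁` and `Δ(Ψ̄_{α'}, Ψ̄_α) ≤ η₁` (mod `q'`),
then `Adv_{Ψ̄_{α'}}[K] ≥ 4θ` (`LWE.abs_distinguishingAdvantage_sub_le`). [cite: RegevLWE2009, Claim 2.2 with §4] -/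
theorem four_theta_le_adv_of_tvDist_le {α α' η₁ : ℝ} (K : (Fin m₃ → (Fin n → ZMod q') × ZMod q') → PMF Bool)
    (hK : 4 * θ + m₃ * η₁ ≤ distinguishingAdvantage (discretizedGaussian q' α) m₃ K)
    (hclose : (discretizedGaussian q' α').tvDist (discretizedGaussian q' α) ≤ η₁) :
    4 * θ ≤ distinguishingAdvantage (discretizedGaussian q' α') m₃ K := by
  have h := abs_distinguishingAdvantage_sub_le (ι := Fin n) (discretizedGaussian q' α') (discretizedGaussian q' α) m₃ K
  rw [abs_le] at h
  nlinarith [h.1, mul_le_mul_of_nonneg_left hclose (Nat.cast_nonneg (α := ℝ) m₃)]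

end Guess

/-! ### §3–§4: the three candidates at dimension `d` -/

section Candidates

variable {n Q q' d : ℕ} [NeZero Q] [NeZero q'] {r B : ℝ} {G : ℕ} {τ : Fin G → ℝ} {m₃ N N' mfel : ℕ} {θ : ℝ}

/-- **§3–§4 at the level of laws, Lemma 4.7 as hypothesis**: from a test `K` of `LWE_{n,q',Ψ̄_α}` (uniform secret,
`m₃` samples, advantage `≥ 4θ`) to THREE tests of the source problems at dimension `d` over `ℤ_Q` —
`E₁, E₃` of `LWE_{d,Q,χ_src}` on `m_fel` samples and `E₂` of `LWE_{d,Q,χ_h}` on `m = G·(N·m₃)` samples — with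
`m(Adv E₁ + ℓ) + Adv E₂ + m(Adv E₃ + ℓ) ≥ 1 - (4(G+1)/(Nθ²) + 8/(N'θ²)) - Δ_LHL`,
`ℓ = ∑_{p∣Q} p^{-(d+1)} + L₄₇`. The `binLWE` test handed to Thm. 4.1 is `A = flatGuessTest K …` and its noise is
the first hybrid's law `noiseH₁ χ_N χ_h` itself (`hη` of Thm. 4.1 with `η = 0`); the Gaussian shape of that law
enters only through `hnoise` (for binary `z`, `Δ(noiseH₁ χ_N χ_h z̄, Ψ̄_{ρ₀(z̄)}) ≤ η₀`, cf.
`LWE.tvDist_noiseH₁_invScaled_le_of_binary`). The test `K` enters only through "for every `z` some guess `w` makes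
`Adv_{Ψ̄_{α(z,w)}}[K] ≥ 4θ`" (`advantage_rateGuess_hybridH₀'`). [cite: BrakerskiEtAl2013, Thm. 4.1 (proof) with Cor. 3.2, Lemma 2.15 and p. 13] -/
theorem section4_three_candidates {ε α₀ η₀ L47 : ℝ} (hn : 0 < n) (hε : 0 < ε) (hε' : ε ≤ 1 / 2)
    (hr : max (Q : ℝ)⁻¹ (q' : ℝ)⁻¹ * Real.sqrt (2 * Real.log (2 * n * (1 + 1 / ε)) / π) ≤ r) (hα₀ : 0 < α₀)
    (hG : 0 < G) (hN : 0 < N) (hN' : 0 < N') (hm₃ : 0 < m₃) (hθ : 0 < θ)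
    (K : (Fin m₃ → (Fin n → ZMod q') × ZMod q') → PMF Bool)
    (χsrc χh : PMF (ZMod Q)) (χN : PMF (Fin n → ℤ)) (ρ₀ : (Fin n → ZMod Q) → ℝ) (ζ : PMF (Fin n → ℤ))
    (hζ : ∀ z ∈ ζ.support, ∀ i, z i = 0 ∨ z i = 1)
    (hnoise : ∀ z ∈ ζ.support, (noiseH₁ χN χh (intCastVec z : Fin n → ZMod Q)).tvDist (discretizedGaussian Q (ρ₀ (intCastVec z))) ≤ η₀)
    (hζ' : ∀ z ∈ ζ.support, ‖intVecToEuclidean n z‖ ≤ B ∧ α₀ ≤ ρ₀ (intCastVec z) ∧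
      ∃ w : Fin G, 4 * θ ≤ distinguishingAdvantage (discretizedGaussian q'
        (Real.sqrt (Real.sqrt (ρ₀ (intCastVec z) ^ 2 + r ^ 2 * (‖intVecToEuclidean n z‖ ^ 2 + B ^ 2)) ^ 2 + τ w ^ 2))) m₃ K)
    (hεθ : m₃ * (4 * ε) ≤ θ / 2) (hQθ : m₃ * (2 / (α₀ * Q) + 10 * ε) + m₃ * η₀ ≤ 2 * θ)
    (h47 : ∀ ζ' : PMF (Fin n → ℤ), (∀ z ∈ ζ'.support, ∀ i, z i = 0 ∨ z i = 1) →
      ∀ D : (Fin n → ℤ) × (Matrix (Fin (d + 1)) (Fin n) (ZMod Q) × (Fin 1 → (Fin n → ZMod Q) × ℤ)) → PMF Bool,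
        ∃ D' : ((Fin (d + 1) → ZMod Q) × ZMod Q) × (Fin mfel → (Fin (d + 1) → ZMod Q) × ZMod Q) → PMF Bool,
          extLWEAdvantageZ ζ' χN 1 D ≤ felAdvantage χsrc mfel D' + L47) :
    ∃ (E₁ E₃ : Distinguisher (Fin d) (ZMod Q) mfel) (E₂ : Distinguisher (Fin d) (ZMod Q) (G * (N * m₃))),
      1 - ((G + 1) * (4 / (N * θ ^ 2)) + 8 / (N' * θ ^ 2)) -
          (lawCz (d + 1) ζ).tvDist (PMF.uniformOfFintype (Matrix (Fin (d + 1)) (Fin n) (ZMod Q) × (Fin (d + 1) → ZMod Q))) ≤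
        (G * (N * m₃) : ℕ) * (distinguishingAdvantage χsrc mfel E₁ + ∑ p ∈ Q.primeFactors, ((p : ℝ) ^ (d + 1))⁻¹ + L47) +
          distinguishingAdvantage χh (G * (N * m₃)) E₂ +
          (G * (N * m₃) : ℕ) * (distinguishingAdvantage χsrc mfel E₃ + ∑ p ∈ Q.primeFactors, ((p : ℝ) ^ (d + 1))⁻¹ + L47) := by
  haveI : NeZero (G * (N * m₃)) := ⟨(Nat.mul_pos hG (Nat.mul_pos hN hm₃)).ne'⟩
  set A := flatGuessTest K N m₃ (rateGuessKernel n Q q' r B τ m₃) (uniformSamples (Fin n) (ZMod q') m₃) N' θ with hA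
  -- Thm. 4.1's bookkeeping for `A`, with `χ₀ := noiseH₁ χN χh` (so `η = 0`)
  obtain ⟨E₁, E₃, E₂, hbound⟩ := blprs_theorem_4_1_bound (k := d) (fun s => noiseH₁ χN χh s) χsrc χh χN (G * (N * m₃)) mfel ζ hζ
    (η := 0) (L47 := L47) (fun z => by rw [PMF.tvDist_self]) h47 A
  -- the rate-guess test's advantage against `H₀`
  have hadv := advantage_rateGuess_hybridH₀' (r := r) (B := B) (τ := τ) (N := N) (N' := N') hn hε hε' hr hα₀ hN hN' hθ K
    (fun s => noiseH₁ χN χh s) ρ₀ ζ (fun z hz => ?_) hεθ hQθ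
  · refine ⟨E₁, E₃, E₂, ?_⟩
    rw [mul_zero, zero_add] at hbound
    rw [← hA] at hadv
    have hle := le_abs_self ((acceptProb A (hybridH₀ (fun s => noiseH₁ χN χh s) (G * (N * m₃)) ζ)).toReal -
      (acceptProb A (uniformSamples (Fin n) (ZMod Q) (G * (N * m₃)))).toReal)
    linarith
  · obtain ⟨hB, hρ, w, hw⟩ := hζ' z hz
    exact ⟨hB, hρ, hnoise z hz, w, hw⟩

end Candidates

/-! ### One problem, one test: transport and selection -/

section Selected

variable {n Q q' d : ℕ} [NeZero Q] [NeZero q'] {r B : ℝ} {G : ℕ} {τ : Fin G → ℝ} {m₃ N N' mfel : ℕ} {θ : ℝ}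

/-- **§3–§4 assembled into ONE test of `LWE_{d,Q,Ψ̄_{α₂}}`** (Lemma 4.7 as hypothesis): with the source noise
`χ_src = Ψ̄_{α₂}` and the branch-2 noise `χ_h = Ψ̄_{√(α₂²+u²)}`, pad the three candidates of
`section4_three_candidates` to `M = max (G·(N·m₃)) m_fel` samples, raise the noise of the middle one by `Ψ̄_u`
(cost `m/(2Qα₂)`), and select the empirically best with its polarity (`N_sel` self-generated runs each): the
resulting explicit-up-to-`h47` test `D` has
`Adv_{Ψ̄_{α₂}}[D] ≥ η⋆/2 - 2·3·32/(N_sel η⋆²)`, `η⋆ = (T - 2mℓ)/(2m+1) - m/(2Qα₂)`,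
`T = 1 - (4(G+1)/(Nθ²) + 8/(N'θ²)) - Δ_LHL`, `ℓ = ∑_{p∣Q} p^{-(d+1)} + L₄₇`, provided `η⋆ > 0`.
[cite: BrakerskiEtAl2013, Thm. 4.1 (proof: "the trivial reduction … incurs no loss"), Cor. 3.2, Lemma 2.15, p. 13; RegevLWE2009, Lemma 4.1] -/
theorem section4_selected {ε α₀ α₂ u η₀ L47 : ℝ} (Nsel : ℕ) (hn : 0 < n) (hε : 0 < ε) (hε' : ε ≤ 1 / 2)
    (hr : max (Q : ℝ)⁻¹ (q' : ℝ)⁻¹ * Real.sqrt (2 * Real.log (2 * n * (1 + 1 / ε)) / π) ≤ r) (hα₀ : 0 < α₀) (hα₂ : 0 < α₂)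
    (hG : 0 < G) (hN : 0 < N) (hN' : 0 < N') (hm₃ : 0 < m₃) (hθ : 0 < θ) (hNsel : 0 < Nsel)
    (K : (Fin m₃ → (Fin n → ZMod q') × ZMod q') → PMF Bool)
    (χN : PMF (Fin n → ℤ)) (ρ₀ : (Fin n → ZMod Q) → ℝ) (ζ : PMF (Fin n → ℤ))
    (hζ : ∀ z ∈ ζ.support, ∀ i, z i = 0 ∨ z i = 1)
    (hnoise : ∀ z ∈ ζ.support, (noiseH₁ χN (discretizedGaussian Q (Real.sqrt (α₂ ^ 2 + u ^ 2))) (intCastVec z : Fin n → ZMod Q)).tvDist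
      (discretizedGaussian Q (ρ₀ (intCastVec z))) ≤ η₀)
    (hζ' : ∀ z ∈ ζ.support, ‖intVecToEuclidean n z‖ ≤ B ∧ α₀ ≤ ρ₀ (intCastVec z) ∧
      ∃ w : Fin G, 4 * θ ≤ distinguishingAdvantage (discretizedGaussian q'
        (Real.sqrt (Real.sqrt (ρ₀ (intCastVec z) ^ 2 + r ^ 2 * (‖intVecToEuclidean n z‖ ^ 2 + B ^ 2)) ^ 2 + τ w ^ 2))) m₃ K)
    (hεθ : m₃ * (4 * ε) ≤ θ / 2) (hQθ : m₃ * (2 / (α₀ * Q) + 10 * ε) + m₃ * η₀ ≤ 2 * θ)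
    (h47 : ∀ ζ' : PMF (Fin n → ℤ), (∀ z ∈ ζ'.support, ∀ i, z i = 0 ∨ z i = 1) →
      ∀ D : (Fin n → ℤ) × (Matrix (Fin (d + 1)) (Fin n) (ZMod Q) × (Fin 1 → (Fin n → ZMod Q) × ℤ)) → PMF Bool,
        ∃ D' : ((Fin (d + 1) → ZMod Q) × ZMod Q) × (Fin mfel → (Fin (d + 1) → ZMod Q) × ZMod Q) → PMF Bool,
          extLWEAdvantageZ ζ' χN 1 D ≤ felAdvantage (discretizedGaussian Q α₂) mfel D' + L47)
    {ηstar : ℝ} (hηstar : 0 < ηstar)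
    (hη : ηstar ≤ (1 - ((G + 1) * (4 / (N * θ ^ 2)) + 8 / (N' * θ ^ 2)) -
          (lawCz (d + 1) ζ).tvDist (PMF.uniformOfFintype (Matrix (Fin (d + 1)) (Fin n) (ZMod Q) × (Fin (d + 1) → ZMod Q))) -
          2 * (G * (N * m₃) : ℕ) * (∑ p ∈ Q.primeFactors, ((p : ℝ) ^ (d + 1))⁻¹ + L47)) / (2 * (G * (N * m₃) : ℕ) + 1) -
        (G * (N * m₃) : ℕ) * (1 / (2 * Q * α₂))) :
    ∃ D : Distinguisher (Fin d) (ZMod Q) (max (G * (N * m₃)) mfel),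
      ηstar / 2 - 2 * ((2 + 1 : ℕ) * (32 / (Nsel * ηstar ^ 2))) ≤
        distinguishingAdvantage (discretizedGaussian Q α₂) (max (G * (N * m₃)) mfel) D := by
  obtain ⟨E₁, E₃, E₂, hsum⟩ := section4_three_candidates (τ := τ) hn hε hε' hr hα₀ hG hN hN' hm₃ hθ K (discretizedGaussian Q α₂)
    (discretizedGaussian Q (Real.sqrt (α₂ ^ 2 + u ^ 2))) χN ρ₀ ζ hζ hnoise hζ' hεθ hQθ h47
  have hmM : G * (N * m₃) ≤ max (G * (N * m₃)) mfel := le_max_left _ _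
  have hfM : mfel ≤ max (G * (N * m₃)) mfel := le_max_right _ _
  -- the three candidates as tests of `LWE_{d,Q,Ψ̄_{α₂}}` on `M = max m m_fel` samples
  have hA₁ : distinguishingAdvantage (discretizedGaussian Q α₂) (max (G * (N * m₃)) mfel) (padThen hfM E₁) =
      distinguishingAdvantage (discretizedGaussian Q α₂) mfel E₁ :=
    distinguishingAdvantage_padThen _ hfM E₁
  have hA₃ : distinguishingAdvantage (discretizedGaussian Q α₂) (max (G * (N * m₃)) mfel) (padThen hfM E₃) =
      distinguishingAdvantage (discretizedGaussian Q α₂) mfel E₃ :=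
    distinguishingAdvantage_padThen _ hfM E₃
  -- the middle one: raising after padding is, at the level of laws, `E₂` against `Ψ̄_{α₂} ⋆ Ψ̄_u` on `m` samples
  have hA₂ : distinguishingAdvantage (discretizedGaussian Q (Real.sqrt (α₂ ^ 2 + u ^ 2))) (G * (N * m₃)) E₂ - (G * (N * m₃) : ℕ) * (1 / (2 * Q * α₂)) ≤
      distinguishingAdvantage (discretizedGaussian Q α₂) (max (G * (N * m₃)) mfel) (raiseThen (discretizedGaussian Q u) (max (G * (N * m₃)) mfel) (padThen hmM E₂)) := by
    have hC₂' : distinguishingAdvantage (discretizedGaussian Q α₂) (max (G * (N * m₃)) mfel) (raiseThen (discretizedGaussian Q u) (max (G * (N * m₃)) mfel) (padThen hmM E₂)) =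
        distinguishingAdvantage (addConv (discretizedGaussian Q α₂) (discretizedGaussian Q u)) (G * (N * m₃)) E₂ := by
      rw [distinguishingAdvantage_raiseThen, distinguishingAdvantage_padThen]
    have habs := abs_distinguishingAdvantage_sub_le (ι := Fin d) (addConv (discretizedGaussian Q α₂) (discretizedGaussian Q u))
      (discretizedGaussian Q (Real.sqrt (α₂ ^ 2 + u ^ 2))) (G * (N * m₃)) E₂
    have htv := tvDist_addConv_discretizedGaussian_le Q hα₂ u
    rw [abs_le] at habs
    rw [hC₂']
    nlinarith [habs.1, mul_le_mul_of_nonneg_left htv (Nat.cast_nonneg (G * (N * m₃)))]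
  -- one of the three is large
  have hsum' : 1 - ((G + 1) * (4 / (N * θ ^ 2)) + 8 / (N' * θ ^ 2)) -
        (lawCz (d + 1) ζ).tvDist (PMF.uniformOfFintype (Matrix (Fin (d + 1)) (Fin n) (ZMod Q) × (Fin (d + 1) → ZMod Q))) ≤
      ((G * (N * m₃) : ℕ) : ℝ) * (distinguishingAdvantage (discretizedGaussian Q α₂) mfel E₁ +
          (∑ p ∈ Q.primeFactors, ((p : ℝ) ^ (d + 1))⁻¹ + L47)) +
        distinguishingAdvantage (discretizedGaussian Q (Real.sqrt (α₂ ^ 2 + u ^ 2))) (G * (N * m₃)) E₂ +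
        ((G * (N * m₃) : ℕ) : ℝ) * (distinguishingAdvantage (discretizedGaussian Q α₂) mfel E₃ +
          (∑ p ∈ Q.primeFactors, ((p : ℝ) ^ (d + 1))⁻¹ + L47)) := by
    linarith [hsum]
  have hcases := exists_ge_of_weighted_sum_ge (x₁ := distinguishingAdvantage (discretizedGaussian Q α₂) mfel E₁)
    (x₂ := distinguishingAdvantage (discretizedGaussian Q (Real.sqrt (α₂ ^ 2 + u ^ 2))) (G * (N * m₃)) E₂)
    (x₃ := distinguishingAdvantage (discretizedGaussian Q α₂) mfel E₃)
    (ℓ := ∑ p ∈ Q.primeFactors, ((p : ℝ) ^ (d + 1))⁻¹ + L47) (Nat.cast_nonneg (G * (N * m₃))) hsum'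
  have hraise0 : 0 ≤ ((G * (N * m₃) : ℕ) : ℝ) * (1 / (2 * Q * α₂)) := by
    have hQ : (0 : ℝ) < Q := by exact_mod_cast Nat.pos_of_ne_zero (NeZero.ne Q)
    positivity
  set E : Fin (2 + 1) → Distinguisher (Fin d) (ZMod Q) (max (G * (N * m₃)) mfel) :=
    ![padThen hfM E₁, raiseThen (discretizedGaussian Q u) (max (G * (N * m₃)) mfel) (padThen hmM E₂), padThen hfM E₃] with hE
  have hbest : ∃ i, ηstar ≤ distinguishingAdvantage (discretizedGaussian Q α₂) (max (G * (N * m₃)) mfel) (E i) := by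
    rcases hcases with h1 | h2 | h3
    · refine ⟨0, ?_⟩
      show ηstar ≤ distinguishingAdvantage (discretizedGaussian Q α₂) (max (G * (N * m₃)) mfel) (padThen hfM E₁)
      rw [hA₁]; linarith
    · refine ⟨1, ?_⟩
      show ηstar ≤ distinguishingAdvantage (discretizedGaussian Q α₂) (max (G * (N * m₃)) mfel) (raiseThen (discretizedGaussian Q u) (max (G * (N * m₃)) mfel) (padThen hmM E₂))
      linarith
    · refine ⟨2, ?_⟩
      show ηstar ≤ distinguishingAdvantage (discretizedGaussian Q α₂) (max (G * (N * m₃)) mfel) (padThen hfM E₃)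
      rw [hA₃]; linarith
  exact ⟨selectDistinguisher (discretizedGaussian Q α₂) E Nsel,
    distinguishingAdvantage_selectDistinguisher_ge hNsel hηstar hbest⟩

end Selected

end BLPRS2013

end Literature.Computability.Cryptography

end
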